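import Literature.NumberTheory.NumberFields.RayClassFieldOfCharacters
import Literature.NumberTheory.EllipticCurves.SingularModuliHilbertClassFieldRange
import HarnessLib

/-!
# Singular moduli of the order of conductor `f` generate extensions of the field of singular moduli
# that are unramified outside `f` (Cox, *Primes of the form x² + ny²*, §9.A with Thm. 11.1)

Topic `NumberTheory/EllipticCurves` (complex multiplication meets class field theory).  Theorem-only
file (no definition, no named fact, D-0026).  Let `K` be imaginary quadratic, `f ≥ 1`, and `Q` a
primitive positive-definite form of discriminant `f² d_K` (a proper ideal class of the order
`𝒪 = ℤ + f𝓞_K` of conductor `f`).  Classically `K(j(𝒪_K), j(Q))` lies in the ring class field of `𝒪`,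
which is contained in the ray class field `K^{(f)}` and hence unramified over `K` outside `f` (Cox
§9.A, p. 181: "the ring class field of conductor `f`… all primes of `K` ramified in `L` divide
`f𝒪_K`"; Thm. 11.1: `K(j(𝔞))` is the ring class field).  This file proves the consequence needed for
the cube/square structure of singular moduli:

* `exists_principalForm_conductor_eq_absNorm_span` — if `a ≡ 1 (mod f𝓞_K)` then `N((a))` is a value
  of the principal form of discriminant `f² d_K` (the norm form of `ℤ + f𝓞_K`, Cox (7.16)/Lemma 7.5);
  `exists_principalForm_conductor_eq_norm_of_sub_intCast_mem` /
  `exists_principalForm_conductor_eq_absNorm_span_of_sub_intCast_mem` — the same for `a ≡ n (mod f𝓞_K)`,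
  `n ∈ ℤ` (any element of the order `ℤ + f𝓞_K`; the generators of `P_{K,ℤ}(f)`, Cox Prop. 7.22);
* `rootSet_minpoly_formJ_conductor_subset_of_principalForm_repr` — for a finite Galois `R ⊆ K̄` over `K`
  in which all but finitely many degree-one primes that split completely have norm represented by the
  principal form of discriminant `f² d_K`, `R` contains every root of the class equation
  `H_{f²d_K} = minpoly_ℚ(j(τ_{P'}))` (Deuring's splitting of principal-form primes,
  `exists_modulus_frobenius_apply_eq_of_singularModulus`, and Bauer's theorem, exactly as for `f = 1`
  in `SingularModuliHilbertClassField.lean`); corollaries `rootSet_minpoly_formJ_conductor_subset`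
  (split primes principal with a generator `≡ 1 mod f`: the RAY class field `mod f`) and
  `rootSet_minpoly_formJ_conductor_subset_of_sub_intCast_mem` (generator `≡ n mod f𝓞_K`, `n ∈ ℤ`:
  the RING class field of conductor `f`, Cox §9.A Thm. 9.2);
* `isUnramifiedIn_adjoin_formJ_conductor` — **for the field of singular moduli
  `H_K = singularModuliField K ι ⊂ ℂ` and `x = j(τ_Q)`, `Q` primitive of discriminant `f² d_K`, the
  extension `H_K(x)/H_K` is unramified at every prime of `𝓞_{H_K}` not containing `f`** — through the
  tree's ray class field `mod f` (`exists_rayClassField_data_principal`), an embedding `K̄ → ℂ` over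
  `ι`, and descent of unramifiedness (`Algebra.IsUnramifiedAt.of_restrictScalars`,
  `IsUnramifiedAt.of_liesOver_of_ne_bot`).

## References

* D. A. Cox, *Primes of the form x² + ny²*, 2nd ed., Wiley 2013: §7.A Lemma 7.2, §7.B Lemma 7.5,
  (7.16), §7.C Prop. 7.22; §8.A Thm. 8.2, 8.6; §9.A (ring class fields, p. 181; Thm. 9.2); §11.A
  Thm. 11.1, §11.D. [Cox2013]
* J. Neukirch, *Algebraic Number Theory* (1999), Ch. VI (6.2)–(6.3), (7.3); Ch. VII (13.9).
  [NeukirchANT1999]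
-/

noncomputable section

open NumberField IsDedekindDomain Polynomial Filter Module

namespace Literature.NumberTheory.EllipticCurves

open Literature.NumberTheory.GaloisRepresentations
open Literature.NumberTheory.NumberFields
open Literature.NumberTheory.QuadraticFields.BinaryQuadraticForm
open Literature.NumberTheory.QuadraticFields.Quadratic

/-! ### Norms of elements `≡ 1 (mod f)` are values of the principal form of discriminant `f² d_K` -/

section NormForm

variable {K : Type*} [Field K] [NumberField K]

/-- `f² D ≡ 0, 1 (mod 4)` when `D ≡ 0, 1 (mod 4)`. [folklore] -/
theorem sq_mul_emod_four {D : ℤ} (h4 : D % 4 = 0 ∨ D % 4 = 1) (f : ℤ) :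
    (f ^ 2 * D) % 4 = 0 ∨ (f ^ 2 * D) % 4 = 1 := by
  rcases Int.even_or_odd f with ⟨k, rfl⟩ | ⟨k, rfl⟩
  · left
    have : (k + k) ^ 2 * D = 4 * (k ^ 2 * D) := by ring
    rw [this, Int.mul_emod_right]
  · have hsq : (2 * k + 1) ^ 2 % 4 = 1 := by
      have : (2 * k + 1) ^ 2 = 4 * (k ^ 2 + k) + 1 := by ring
      rw [this]; omega
    rcases h4 with h | h
    · left
      rw [Int.mul_emod, hsq, h]; norm_num
    · right
      rw [Int.mul_emod, hsq, h]; norm_num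

/-- **Norms from the order `ℤ + f𝓞_K` of conductor `f` are values of the principal form of
discriminant `f² d_K`** (`[K:ℚ] = 2`): if `a ≡ n (mod f𝓞_K)` for a rational integer `n` — i.e.
`a ∈ ℤ + f𝓞_K` — then `N_{K/ℚ}(a) = x² + B'xy + C'y²` with `(1, B', C') = principalForm (f² d_K)`.
(In an integral basis `(1, ω)`, `ω² = m + tω`: `a = X + fn'ω` with `X = n + fm'`,
`N(a) = X² + (tf)X n' − (mf²)n'²`, a value of the form `(1, tf, −mf²)` of discriminant
`f²(t² + 4m) = f² d_K`; forms `(1, ·, ·)` of equal discriminant represent the same integers,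
`exists_norm_repr_of_repr`.)  Cox, Lemma 7.5 / (7.16): "`𝒪 = ℤ + f𝒪_K`" (Lemma 7.2) and the norm
form of `𝒪`; this is the ring-class shape (`α ≡ a mod f𝒪_K`, `a ∈ ℤ`, the generators of
`P_{K,ℤ}(f)`, Cox §7.C Prop. 7.22) of `exists_principalForm_conductor_eq_norm` below.
[cite: Cox2013, §7.A Lemma 7.2, §7.B Lemma 7.5 and (7.16), §7.C Prop. 7.22] -/
theorem exists_principalForm_conductor_eq_norm_of_sub_intCast_mem (h2 : finrank ℚ K = 2) {f : ℕ}
    {a : 𝓞 K} {n : ℤ} (ha : a - n ∈ Ideal.span {((f : ℕ) : 𝓞 K)}) :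
    ∃ x y : ℤ, x ^ 2 + (principalForm ((f : ℤ) ^ 2 * NumberField.discr K)).2.1 * x * y +
      (principalForm ((f : ℤ) ^ 2 * NumberField.discr K)).2.2 * y ^ 2 = Algebra.norm ℤ a := by
  obtain ⟨b, hb⟩ := exists_basis_zero_eq_one (K := K) h2
  set m : ℤ := b.repr (b 1 * b 1) 0 with hm
  set t : ℤ := b.repr (b 1 * b 1) 1 with ht
  set D' : ℤ := (f : ℤ) ^ 2 * NumberField.discr K with hD'
  -- `a - n = f β`, `β = m' + n' ω`, so `a = (n + f m') + (f n') ω`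
  obtain ⟨β, hβ⟩ := Ideal.mem_span_singleton'.mp ha
  set m' : ℤ := b.repr β 0 with hm'
  set n' : ℤ := b.repr β 1 with hn'
  have hβeq : β = (m' : 𝓞 K) + (n' : 𝓞 K) * b 1 := by
    conv_lhs => rw [← b.sum_repr β]
    rw [Fin.sum_univ_two, hb, zsmul_eq_mul, mul_one, zsmul_eq_mul]
  have haeq : a = ((n + f * m' : ℤ) : 𝓞 K) + ((f * n' : ℤ) : 𝓞 K) * b 1 := by
    have : a = n + β * ((f : ℕ) : 𝓞 K) := by rw [hβ]; ring
    rw [this, hβeq]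
    push_cast
    ring
  have hω : b 1 * b 1 = (m : 𝓞 K) + (t : 𝓞 K) * b 1 := basis_one_mul_self_eq b hb
  have hN : Algebra.norm ℤ a = (n + f * m') ^ 2 + t * (n + f * m') * (f * n') - m * (f * n') ^ 2 := by
    rw [haeq, norm_intCast_add_intCast_mul b hb hω]
  -- the form `(1, tf, −mf²)` has discriminant `f² d_K`
  have hD : NumberField.discr K = t ^ 2 + 4 * m := discr_eq_sq_add_four_mul b hb
  have h4 : NumberField.discr K % 4 = 0 ∨ NumberField.discr K % 4 = 1 := discr_emod_four h2
  have h4' : D' % 4 = 0 ∨ D' % 4 = 1 := sq_mul_emod_four h4 f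
  have hP : (principalForm D').2.1 ^ 2 - 4 * (principalForm D').2.2 = D' := by
    have h1 := discr_principalForm h4'
    have h2' : discr (principalForm D') = (principalForm D').2.1 ^ 2 -
        4 * (principalForm D').1 * (principalForm D').2.2 := rfl
    rw [principalForm_fst] at h2'
    linear_combination -h2' + h1
  have hrep : (n + f * m') ^ 2 + (t * f) * (n + f * m') * n' + (-(m * f ^ 2)) * n' ^ 2 =
      Algebra.norm ℤ a := by rw [hN]; ring
  have hdisc : (t * (f : ℤ)) ^ 2 - 4 * (-(m * (f : ℤ) ^ 2)) = (principalForm D').2.1 ^ 2 -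
      4 * 1 * (principalForm D').2.2 := by
    rw [hD'] at hP
    linear_combination -(f : ℤ) ^ 2 * hD - hP
  obtain ⟨u, v, huv⟩ := exists_norm_repr_of_repr (a := 1) hdisc hrep
  refine ⟨u, -v, ?_⟩
  linear_combination huv

/-- **Norms from `ℤ + f𝓞_K` are values of the principal form of discriminant `f² d_K`** (`[K:ℚ] = 2`):
if `a ≡ 1 (mod f𝓞_K)` then `N_{K/ℚ}(a) = x² + B'xy + C'y²` with `(1, B', C') = principalForm (f² d_K)`.
(In an integral basis `(1, ω)`, `ω² = m + tω`: `a = X + fnω`, `N(a) = X² + (tf)X n − (mf²)n²`, a value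
of the form `(1, tf, −mf²)` of discriminant `f²(t² + 4m) = f² d_K`; forms `(1, ·, ·)` of equal
discriminant represent the same integers, `exists_norm_repr_of_repr`.)  Cox, Lemma 7.5 / (7.16): the
norm form of the order of conductor `f`.  The case `n = 1` of
`exists_principalForm_conductor_eq_norm_of_sub_intCast_mem`. [cite: Cox2013, §7.B Lemma 7.5 and (7.16)] -/
theorem exists_principalForm_conductor_eq_norm (h2 : finrank ℚ K = 2) {f : ℕ} {a : 𝓞 K}
    (ha : a - 1 ∈ Ideal.span {((f : ℕ) : 𝓞 K)}) :
    ∃ x y : ℤ, x ^ 2 + (principalForm ((f : ℤ) ^ 2 * NumberField.discr K)).2.1 * x * y +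
      (principalForm ((f : ℤ) ^ 2 * NumberField.discr K)).2.2 * y ^ 2 = Algebra.norm ℤ a :=
  exists_principalForm_conductor_eq_norm_of_sub_intCast_mem h2 (n := 1) (by simpa using ha)

/-- For `K` imaginary quadratic (`d_K < 0`), **the absolute norm of `(a)` with `a ≡ n (mod f)`,
`n ∈ ℤ` — a principal ideal with a generator in the order `ℤ + f𝓞_K` — is a value of the principal
form of discriminant `f² d_K`** (Cox, Thm. 9.2 / (7.16): the norms of the principal `𝒪`-ideals prime
to `f`, `𝒪 = ℤ + f𝒪_K`, are the values of the principal form; the generators of `P_{K,ℤ}(f)`,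
Prop. 7.22).  The ring-class shape of `exists_principalForm_conductor_eq_absNorm_span` below.
[cite: Cox2013, §7.B Lemma 7.5 and (7.16), §7.C Prop. 7.22; §9.A Thm. 9.2] -/
theorem exists_principalForm_conductor_eq_absNorm_span_of_sub_intCast_mem (h2 : finrank ℚ K = 2)
    (hneg : NumberField.discr K < 0) {f : ℕ} (hf : f ≠ 0) {a : 𝓞 K} {n : ℤ}
    (ha : a - n ∈ Ideal.span {((f : ℕ) : 𝓞 K)}) :
    ∃ x y : ℤ, x ^ 2 + (principalForm ((f : ℤ) ^ 2 * NumberField.discr K)).2.1 * x * y +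
      (principalForm ((f : ℤ) ^ 2 * NumberField.discr K)).2.2 * y ^ 2 =
        Ideal.absNorm (Ideal.span {a}) := by
  obtain ⟨x, y, hxy⟩ := exists_principalForm_conductor_eq_norm_of_sub_intCast_mem h2 ha
  refine ⟨x, y, ?_⟩
  rw [Ideal.absNorm_span_singleton, hxy]
  set D' : ℤ := (f : ℤ) ^ 2 * NumberField.discr K with hD'
  have h4' : D' % 4 = 0 ∨ D' % 4 = 1 := sq_mul_emod_four (discr_emod_four h2) f
  have hP : (principalForm D').2.1 ^ 2 - 4 * (principalForm D').2.2 = D' := by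
    have h1 := discr_principalForm h4'
    have h2' : discr (principalForm D') = (principalForm D').2.1 ^ 2 -
        4 * (principalForm D').1 * (principalForm D').2.2 := rfl
    rw [principalForm_fst] at h2'
    linear_combination -h2' + h1
  have hD'neg : D' < 0 := by
    have hf' : (0 : ℤ) < (f : ℤ) ^ 2 := by positivity
    exact mul_neg_of_pos_of_neg hf' hneg
  have hnn : 0 ≤ Algebra.norm ℤ a := by
    rw [← hxy]
    nlinarith [sq_nonneg (2 * x + (principalForm D').2.1 * y), sq_nonneg y, hP, hD'neg]
  exact (Int.natAbs_of_nonneg hnn).symm ▸ rfl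

/-- Hence, for `K` imaginary quadratic (`d_K < 0`), **the absolute norm of `(a)` with `a ≡ 1 (mod f)`
is a value of the principal form of discriminant `f² d_K`**. [cite: Cox2013, §7.B Lemma 7.5 and (7.16); §9.A] -/
theorem exists_principalForm_conductor_eq_absNorm_span (h2 : finrank ℚ K = 2)
    (hneg : NumberField.discr K < 0) {f : ℕ} (hf : f ≠ 0) {a : 𝓞 K}
    (ha : a - 1 ∈ Ideal.span {((f : ℕ) : 𝓞 K)}) :
    ∃ x y : ℤ, x ^ 2 + (principalForm ((f : ℤ) ^ 2 * NumberField.discr K)).2.1 * x * y +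
      (principalForm ((f : ℤ) ^ 2 * NumberField.discr K)).2.2 * y ^ 2 =
        Ideal.absNorm (Ideal.span {a}) := by
  obtain ⟨x, y, hxy⟩ := exists_principalForm_conductor_eq_norm h2 ha
  refine ⟨x, y, ?_⟩
  rw [Ideal.absNorm_span_singleton, hxy]
  set D' : ℤ := (f : ℤ) ^ 2 * NumberField.discr K with hD'
  have h4' : D' % 4 = 0 ∨ D' % 4 = 1 := sq_mul_emod_four (discr_emod_four h2) f
  have hP : (principalForm D').2.1 ^ 2 - 4 * (principalForm D').2.2 = D' := by
    have h1 := discr_principalForm h4'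
    have h2' : discr (principalForm D') = (principalForm D').2.1 ^ 2 -
        4 * (principalForm D').1 * (principalForm D').2.2 := rfl
    rw [principalForm_fst] at h2'
    linear_combination -h2' + h1
  have hD'neg : D' < 0 := by
    have hf' : (0 : ℤ) < (f : ℤ) ^ 2 := by positivity
    exact mul_neg_of_pos_of_neg hf' hneg
  have hnn : 0 ≤ Algebra.norm ℤ a := by
    rw [← hxy]
    nlinarith [sq_nonneg (2 * x + (principalForm D').2.1 * y), sq_nonneg y, hP, hD'neg]
  exact (Int.natAbs_of_nonneg hnn).symm ▸ rfl

end NormForm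

/-! ### The singular moduli of discriminant `f² d_K` lie in the ray class field `mod f` -/

section Containment

variable (K : Type) [Field K] [NumberField K]

/-- **`K(j(τ_Q)) ⊆ R` for `Q` of discriminant `f² d_K` when the degree-one primes that split
completely in `R` have norm represented by the principal form of discriminant `f² d_K`** — the common
generalisation of the ray-class shape (`rootSet_minpoly_formJ_conductor_subset`: split primes `(a)`,
`a ≡ 1 mod f`) and the ring-class shape (`rootSet_minpoly_formJ_conductor_subset_of_sub_intCast_mem`:
split primes `(a)`, `a ≡ n mod f𝓞_K`, `n ∈ ℤ`, i.e. principal `𝒪`-ideals of `𝒪 = ℤ + f𝓞_K`, the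
characteristic property of the RING class field of `𝒪`: Cox Thm. 9.2 "`p` is represented by the
principal form of discriminant `f² d_K` iff `p` splits completely in the ring class field").  Let `K` be
imaginary quadratic, `f ≥ 1`, and `R ⊂ K̄` finite Galois over `K` such that, with finitely many
exceptions, every degree-one prime `v` of `K` splitting completely in `R` has `N(v) = x² + B'xy + C'y²`
for some `x, y ∈ ℤ`, `(1, B', C')` the principal form of discriminant `f² d_K`.  Then every root in `K̄` of
`H_{f²d_K} = minpoly_ℚ(j(τ_{P'}))` lies in `R`.  Proof (Deuring + Bauer): as for
`rootSet_minpoly_formJ_subset_of_splitPrimes_principal` — a Frobenius at a prime of the compositum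
`R·K(roots)` above such a `v` (off the modulus of `exists_modulus_frobenius_apply_eq_of_singularModulus`)
fixes every root of `H_{f²d_K}`, so `v` splits completely in `K(roots)`, and Bauer's theorem in
degree-one form (`le_of_splitPrimes_subset_of_prime_absNorm`) gives `K(roots) ⊆ R`.
[cite: Cox2013, §9.A Thm. 9.2 and §11.A Thm. 11.1, §11.D] [cite: NeukirchANT1999, Ch. VII Prop. (13.9)] -/
theorem rootSet_minpoly_formJ_conductor_subset_of_principalForm_repr (hK : IsImaginaryQuadratic K)
    {f : ℕ} (hf : f ≠ 0) (R : IntermediateField K (AlgebraicClosure K)) [FiniteDimensional K R]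
    [IsGalois K R]
    (hspl : ∀ᶠ v : HeightOneSpectrum (𝓞 K) in cofinite, (Ideal.absNorm v.asIdeal).Prime →
      v ∈ splitPrimes K R → ∃ x y : ℤ,
        x ^ 2 + (principalForm ((f : ℤ) ^ 2 * NumberField.discr K)).2.1 * x * y +
          (principalForm ((f : ℤ) ^ 2 * NumberField.discr K)).2.2 * y ^ 2 =
            Ideal.absNorm v.asIdeal) :
    ((minpoly ℚ (formJ (principalForm ((f : ℤ) ^ 2 * NumberField.discr K)))).map
      (algebraMap ℚ K)).rootSet (AlgebraicClosure K) ⊆ R := by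
  classical
  set Ω := AlgebraicClosure K
  set D' : ℤ := (f : ℤ) ^ 2 * NumberField.discr K with hD'def
  have h2 : Module.finrank ℚ K = 2 := hK.1
  have hD : NumberField.discr K < 0 := hK.discr_neg
  have h4 : NumberField.discr K % 4 = 0 ∨ NumberField.discr K % 4 = 1 := discr_emod_four h2
  have hD' : D' < 0 := mul_neg_of_pos_of_neg (by positivity) hD
  have h4' : D' % 4 = 0 ∨ D' % 4 = 1 := sq_mul_emod_four h4 f
  have hP : principalForm D' ∈ reducedForms D' := principalForm_mem_reducedForms hD' h4'
  haveI : NumberField R := NumberField.of_module_finite K R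
  set g : ℚ[X] := minpoly ℚ (formJ (principalForm D')) with hgdef
  set fK : K[X] := g.map (algebraMap ℚ K) with hfdef
  -- the field `M' = K(roots of H_{D'})` and the compositum `L₀ = R M'`
  set M' : IntermediateField K Ω := IntermediateField.adjoin K (fK.rootSet Ω) with hM'def
  haveI : FiniteDimensional K M' :=
    IntermediateField.finiteDimensional_adjoin fun x _ => Algebra.IsIntegral.isIntegral x
  haveI : Normal K M' := by
    haveI := IntermediateField.adjoin_rootSet_isSplittingField
      (IsAlgClosed.splits (fK.map (algebraMap K Ω)))
    exact Normal.of_isSplittingField fK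
  set L₀ : IntermediateField K Ω := R ⊔ M' with hL₀def
  haveI : Normal K L₀ := inferInstance
  haveI : IsGalois K L₀ := IsGalois.mk
  haveI : NumberField L₀ := NumberField.of_module_finite K L₀
  set E₁ : IntermediateField K L₀ := IntermediateField.restrict (le_sup_left : R ≤ L₀) with hE₁
  set E₂ : IntermediateField K L₀ := IntermediateField.restrict (le_sup_right : M' ≤ L₀) with hE₂
  haveI : IsGalois K E₁ := IsGalois.of_algEquiv (IntermediateField.restrict_algEquiv _)
  haveI : IsGalois K M' := IsGalois.mk
  haveI : IsGalois K E₂ := IsGalois.of_algEquiv (IntermediateField.restrict_algEquiv _)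
  haveI : NumberField E₁ := NumberField.of_module_finite K E₁
  haveI : NumberField E₂ := NumberField.of_module_finite K E₂
  -- it suffices that `E₂ ≤ E₁`
  suffices hle : E₂ ≤ E₁ by
    intro t ht
    have htM : t ∈ M' := IntermediateField.subset_adjoin K _ ht
    have htL : t ∈ L₀ := (le_sup_right : M' ≤ L₀) htM
    have h2' : (⟨t, htL⟩ : L₀) ∈ E₂ :=
      (IntermediateField.mem_restrict (le_sup_right : M' ≤ L₀) ⟨t, htL⟩).mpr htM
    exact (IntermediateField.mem_restrict (le_sup_left : R ≤ L₀) ⟨t, htL⟩).mp (hle h2')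
  -- an embedding of `L₀` into `ℂ`
  haveI : Algebra.IsAlgebraic ℚ Ω := Algebra.IsAlgebraic.trans ℚ K Ω
  set ψ : Ω →ₐ[ℚ] ℂ := IsAlgClosed.lift with hψdef
  set e : L₀ →+* ℂ := ψ.toRingHom.comp (algebraMap L₀ Ω) with hedef
  -- Deuring: the modulus `N` beyond which Frobenii fix the singular moduli of discriminant `D'`
  obtain ⟨N, hN0, hmain⟩ := exists_modulus_frobenius_apply_eq_of_singularModulus hD' h4' L₀ e
  -- Bauer, degree-one form
  refine Literature.NumberTheory.NumberFields.le_of_splitPrimes_subset_of_prime_absNorm E₁ E₂ ?_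
  have hfinN : {v : HeightOneSpectrum (𝓞 K) | Ideal.absNorm v.asIdeal ∣ N}.Finite := by
    refine ((N.divisors.finite_toSet).biUnion fun d _ =>
      Literature.NumberTheory.LFunctions.finite_setOf_absNorm_asIdeal_eq K d).subset ?_
    intro v hv
    exact Set.mem_biUnion (Nat.mem_divisors.mpr ⟨hv, hN0⟩) rfl
  have hev : ∀ᶠ v : HeightOneSpectrum (𝓞 K) in cofinite, ¬ Ideal.absNorm v.asIdeal ∣ N ∧
      Algebra.IsUnramifiedIn (𝓞 L₀) v.asIdeal ∧ Algebra.IsUnramifiedIn (𝓞 E₂) v.asIdeal ∧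
      ((Ideal.absNorm v.asIdeal).Prime → v ∈ splitPrimes K R →
        ∃ x y : ℤ, x ^ 2 + (principalForm D').2.1 * x * y + (principalForm D').2.2 * y ^ 2 =
          Ideal.absNorm v.asIdeal) := by
    have hA : ∀ᶠ v : HeightOneSpectrum (𝓞 K) in cofinite, ¬ Ideal.absNorm v.asIdeal ∣ N := by
      rw [Filter.eventually_cofinite]
      simpa using hfinN
    have hB : ∀ᶠ v : HeightOneSpectrum (𝓞 K) in cofinite, Algebra.IsUnramifiedIn (𝓞 L₀) v.asIdeal :=
      Filter.eventually_cofinite.mpr (finite_setOf_not_isUnramifiedIn K L₀)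
    have hC : ∀ᶠ v : HeightOneSpectrum (𝓞 K) in cofinite, Algebra.IsUnramifiedIn (𝓞 E₂) v.asIdeal :=
      Filter.eventually_cofinite.mpr (finite_setOf_not_isUnramifiedIn K E₂)
    exact hA.and (hB.and (hC.and hspl))
  refine hev.mono ?_
  rintro v ⟨hvN, hunrL, hunr₂, hsplv⟩ hprime hv₁
  set p : ℕ := Ideal.absNorm v.asIdeal with hpdef
  -- `v` splits completely in `R` and has prime norm `p`: `p` is represented by the principal form
  have hvR : v ∈ splitPrimes K R := by
    rw [splitPrimes_eq_of_algEquiv (IntermediateField.restrict_algEquiv (le_sup_left : R ≤ L₀))]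
    exact hv₁
  have hrep : ∃ x y : ℤ, x ^ 2 + (principalForm D').2.1 * x * y + (principalForm D').2.2 * y ^ 2 = p :=
    hsplv hprime hvR
  -- a prime of `𝓞 L₀` above `v` and the Frobenius there
  haveI := v.isMaximal
  obtain ⟨Q, hQmax, hQover⟩ := Ideal.exists_maximal_ideal_liesOver_of_isIntegral (S := 𝓞 L₀) v.asIdeal
  haveI := hQmax
  haveI := hQover
  have hQ : Q ∈ v.asIdeal.primesOver (𝓞 L₀) := ⟨hQmax.isPrime, hQover⟩
  have hQbot : Q ≠ ⊥ := Ideal.ne_bot_of_liesOver_of_ne_bot v.ne_bot Q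
  obtain ⟨φ, hφ⟩ := exists_isArithFrobAt_ringOfIntegers (M := K) Q hQbot
  have hcard : Nat.card (𝓞 K ⧸ Q.under (𝓞 K)) = p := by
    rw [← hQover.over, ← Submodule.cardQuot_apply, ← Ideal.absNorm_apply]
  have hφp : ∀ x : 𝓞 L₀, (φ.restrictScalars ℚ) • x - x ^ p ∈ Q := fun x => by
    have h := hφ x
    rw [hcard, MulSemiringAction.toAlgHom_apply] at h
    have hsm : (φ.restrictScalars ℚ) • x = φ • x := Subtype.ext rfl
    rw [hsm]
    exact h
  have hpQ : (p : 𝓞 L₀) ∈ Q := by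
    have h1 : (p : 𝓞 K) ∈ Q.under (𝓞 K) := by
      rw [← hQover.over, hpdef]
      exact Ideal.absNorm_mem v.asIdeal
    have h2 : algebraMap (𝓞 K) (𝓞 L₀) (p : 𝓞 K) ∈ Q := Ideal.mem_comap.mp h1
    rwa [map_natCast] at h2
  -- the Frobenius fixes the roots of `H_{D'}` in `L₀`
  have hfix : ∀ t : L₀, (t : Ω) ∈ fK.rootSet Ω → φ t = t := by
    intro t ht
    have het : e t ∈ (reducedForms D').image formJ := by
      apply mem_image_formJ_of_eval_classPolynomial
      rw [← minpoly_formJ_map_eq_classPolynomial hD' hP, eval_map, ← aeval_def]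
      rw [mem_rootSet] at ht
      have h1 : aeval (t : Ω) g = 0 := by
        have := ht.2
        rwa [hfdef, aeval_map_algebraMap] at this
      have h2 : aeval (ψ (t : Ω)) g = 0 := by rw [aeval_algHom_apply, h1, map_zero]
      exact h2
    exact hmain p hprime (fun h => hvN h) hrep Q hQmax hpQ (φ.restrictScalars ℚ) hφp t het
  -- hence `φ` fixes `E₂`, so `v` splits completely in `E₂`
  have hfixE₂ : φ ∈ E₂.fixingSubgroup := by
    rw [IntermediateField.mem_fixingSubgroup_iff]
    intro x hx
    set Fφ : IntermediateField K L₀ := IntermediateField.fixedField (Subgroup.zpowers φ) with hFφ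
    have hmemF : ∀ y : L₀, φ y = y → y ∈ Fφ := fun y hy => by
      rw [hFφ, IntermediateField.mem_fixedField_iff]
      intro g' hg'
      obtain ⟨k, rfl⟩ := Subgroup.mem_zpowers_iff.mp hg'
      have hpos : ∀ n : ℕ, (φ ^ n) y = y := by
        intro n
        induction n with
        | zero => simp
        | succ n ih => rw [pow_succ, AlgEquiv.mul_apply, hy, ih]
      rcases Int.eq_nat_or_neg k with ⟨n, rfl | rfl⟩
      · rw [zpow_natCast]; exact hpos n
      · rw [_root_.zpow_neg, zpow_natCast]
        have := hpos n
        conv_lhs => rw [← this]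
        rw [← AlgEquiv.mul_apply, inv_mul_cancel, AlgEquiv.one_apply]
    have hM'le : M' ≤ IntermediateField.lift Fφ := by
      rw [hM'def, IntermediateField.adjoin_le_iff]
      intro t ht
      have htL : t ∈ L₀ := (le_sup_right : M' ≤ L₀) (IntermediateField.subset_adjoin K _ ht)
      exact (IntermediateField.mem_lift ⟨t, htL⟩).mpr (hmemF _ (hfix ⟨t, htL⟩ ht))
    have hxM : (x : Ω) ∈ M' := (IntermediateField.mem_restrict (le_sup_right : M' ≤ L₀) x).mp hx
    have hxF : x ∈ Fφ := (IntermediateField.mem_lift x).mp (hM'le hxM)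
    rw [hFφ, IntermediateField.mem_fixedField_iff] at hxF
    exact hxF φ (Subgroup.mem_zpowers φ)
  exact (mem_splitPrimes_intermediateField_iff E₂ hunrL hunr₂ hQ hφ).mpr hfixE₂

/-- **`K(j(τ_Q)) ⊆ R` for `Q` of discriminant `f² d_K` when the primes that split completely in `R`
are principal with generator `≡ 1 (mod f)`** (Cox Thm. 11.1 for the order of conductor `f`,
containment half, via §9.A/Thm. 9.2 "`p` is represented by the principal form of discriminant
`f² d_K` iff `p` splits completely in the ring class field" and Bauer's theorem).  Let `K` be
imaginary quadratic, `f ≥ 1`, and `R ⊂ K̄` finite Galois over `K` such that, with finitely many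
exceptions, every degree-one prime of `K` splitting completely in `R` is `(a)` with `a - 1 ∈ f𝓞_K`.
Then every root in `K̄` of `H_{f²d_K} = minpoly_ℚ(j(τ_{P'}))`, `P'` the principal form of discriminant
`f² d_K`, lies in `R`.  The case of
`rootSet_minpoly_formJ_conductor_subset_of_principalForm_repr` in which the representation comes from the
norm form of `ℤ + f𝓞_K` (`exists_principalForm_conductor_eq_absNorm_span`).
[cite: Cox2013, §9.A Thm. 9.2 and §11.A Thm. 11.1, §11.D] [cite: NeukirchANT1999, Ch. VII Prop. (13.9)] -/
theorem rootSet_minpoly_formJ_conductor_subset (hK : IsImaginaryQuadratic K) {f : ℕ} (hf : f ≠ 0)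
    (R : IntermediateField K (AlgebraicClosure K)) [FiniteDimensional K R] [IsGalois K R]
    (hspl : ∀ᶠ v : HeightOneSpectrum (𝓞 K) in cofinite, (Ideal.absNorm v.asIdeal).Prime →
      v ∈ splitPrimes K R → ∃ a : 𝓞 K, v.asIdeal = Ideal.span {a} ∧
        a - 1 ∈ Ideal.span {((f : ℕ) : 𝓞 K)}) :
    ((minpoly ℚ (formJ (principalForm ((f : ℤ) ^ 2 * NumberField.discr K)))).map
      (algebraMap ℚ K)).rootSet (AlgebraicClosure K) ⊆ R := by
  classical
  refine rootSet_minpoly_formJ_conductor_subset_of_principalForm_repr K hK hf R (hspl.mono ?_)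
  intro v hv hprime hsplit
  obtain ⟨a, ha, ha1⟩ := hv hprime hsplit
  obtain ⟨x, y, hxy⟩ := exists_principalForm_conductor_eq_absNorm_span hK.1 hK.discr_neg hf ha1
  exact ⟨x, y, by rw [hxy, ha]⟩

/-- **Ring-class shape: `K(j(τ_Q)) ⊆ R` for `Q` of discriminant `f² d_K` when the degree-one primes
that split completely in `R` are principal with a generator in `ℤ + f𝓞_K`** (`v = (a)` with
`a ≡ n (mod f𝓞_K)` for some `n ∈ ℤ` — the generators of `P_{K,ℤ}(f)`, Cox Prop. 7.22, i.e. `v` has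
trivial class in the ring class group `I_K(f)/P_{K,ℤ}(f) ≅ Pic(ℤ + f𝓞_K)`; this is the splitting law of
the RING class field of conductor `f`, Cox §9.A / Thm. 9.2, whereas `rootSet_minpoly_formJ_conductor_subset`
is phrased for the ray `a ≡ 1`).  With finitely many exceptions allowed.  From
`rootSet_minpoly_formJ_conductor_subset_of_principalForm_repr` and the norm form of `ℤ + f𝓞_K`
(`exists_principalForm_conductor_eq_absNorm_span_of_sub_intCast_mem`).
[cite: Cox2013, §7.C Prop. 7.22, §9.A Thm. 9.2, §11.A Thm. 11.1] [cite: NeukirchANT1999, Ch. VII Prop. (13.9)] -/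
theorem rootSet_minpoly_formJ_conductor_subset_of_sub_intCast_mem (hK : IsImaginaryQuadratic K)
    {f : ℕ} (hf : f ≠ 0) (R : IntermediateField K (AlgebraicClosure K)) [FiniteDimensional K R]
    [IsGalois K R]
    (hspl : ∀ᶠ v : HeightOneSpectrum (𝓞 K) in cofinite, (Ideal.absNorm v.asIdeal).Prime →
      v ∈ splitPrimes K R → ∃ (a : 𝓞 K) (n : ℤ), v.asIdeal = Ideal.span {a} ∧
        a - n ∈ Ideal.span {((f : ℕ) : 𝓞 K)}) :
    ((minpoly ℚ (formJ (principalForm ((f : ℤ) ^ 2 * NumberField.discr K)))).map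
      (algebraMap ℚ K)).rootSet (AlgebraicClosure K) ⊆ R := by
  classical
  refine rootSet_minpoly_formJ_conductor_subset_of_principalForm_repr K hK hf R (hspl.mono ?_)
  intro v hv hprime hsplit
  obtain ⟨a, n, ha, han⟩ := hv hprime hsplit
  obtain ⟨x, y, hxy⟩ :=
    exists_principalForm_conductor_eq_absNorm_span_of_sub_intCast_mem hK.1 hK.discr_neg hf han
  exact ⟨x, y, by rw [hxy, ha]⟩


/-- **The ray class field `mod f` contains the singular moduli of discriminants `d_K` and `f² d_K`.**
For `K` imaginary quadratic and `f ≥ 1` there is a finite Galois `R ⊆ K̄` over `K`, unramified at every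
prime `v ∤ f`, containing every root of `H_{d_K}` and of `H_{f² d_K}` (the tree's ray class field,
`exists_rayClassField_data_principal`, and the two containments).  [cite: Cox2013, §9.A and §11.A Thm. 11.1]
[cite: NeukirchANT1999, Ch. VI (6.2)–(6.3), (7.3)] -/
theorem exists_unramified_rootSet_subset_conductor (hK : IsImaginaryQuadratic K) {f : ℕ} (hf : f ≠ 0) :
    ∃ R : IntermediateField K (AlgebraicClosure K), FiniteDimensional K R ∧ IsGalois K R ∧
      (∀ v : HeightOneSpectrum (𝓞 K), ¬ Ideal.span {((f : ℕ) : 𝓞 K)} ≤ v.asIdeal →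
        Algebra.IsUnramifiedIn (𝓞 R) v.asIdeal) ∧
      ((minpoly ℚ (formJ (principalForm (NumberField.discr K)))).map (algebraMap ℚ K)).rootSet
        (AlgebraicClosure K) ⊆ R ∧
      ((minpoly ℚ (formJ (principalForm ((f : ℤ) ^ 2 * NumberField.discr K)))).map
        (algebraMap ℚ K)).rootSet (AlgebraicClosure K) ⊆ R := by
  have h𝔪 : Ideal.span {((f : ℕ) : 𝓞 K)} ≠ ⊥ := by
    rw [Ne, Ideal.span_singleton_eq_bot]
    exact_mod_cast hf
  obtain ⟨R, hfd, hgal, hunr, hspl⟩ := exists_rayClassField_data_principal (K := K) h𝔪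
  haveI := hfd
  haveI := hgal
  have hfin : {v : HeightOneSpectrum (𝓞 K) | Ideal.span {((f : ℕ) : 𝓞 K)} ≤ v.asIdeal}.Finite :=
    finite_setOf_le_asIdeal h𝔪
  have hev : ∀ᶠ v : HeightOneSpectrum (𝓞 K) in cofinite, ¬ Ideal.span {((f : ℕ) : 𝓞 K)} ≤ v.asIdeal := by
    rw [Filter.eventually_cofinite]
    simpa using hfin
  refine ⟨R, hfd, hgal, hunr, ?_, ?_⟩
  · refine rootSet_minpoly_formJ_subset_of_splitPrimes_principal K hK R ?_
    refine hev.mono fun v hv _ hsplit => ?_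
    obtain ⟨a, ha, -⟩ := hspl v hv hsplit
    exact ⟨⟨a, ha⟩⟩
  · refine rootSet_minpoly_formJ_conductor_subset K hK hf R ?_
    exact hev.mono fun v hv _ hsplit => hspl v hv hsplit

end Containment

/-! ### Unramifiedness of `H_K(j(τ_Q))/H_K` outside the conductor -/

section Unramified

open IntermediateField

variable {K : Type} [Field K] [NumberField K]

/-- **`H_K(j(τ_Q))/H_K` is unramified at the primes not containing `f`**, for `Q` primitive positive
definite of discriminant `f² d_K` (`f ≥ 1`) and `H_K = singularModuliField K ι ⊂ ℂ` the field of
singular moduli of `K` (≅ the Hilbert class field).  Classically: `H_K(j(τ_Q))` lies in the ring class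
field of the order of conductor `f` (Cox Thm. 11.1), inside the ray class field `K^{(f)}`, which is
unramified over `K` outside `f` (Cox §9.A, p. 181; Neukirch VI (6.2)–(6.3)).  Proof: take the tree's
ray class field `R ⊂ K̄` `mod f` (`exists_unramified_rootSet_subset_conductor`: finite Galois over `K`,
unramified off `f`, containing the roots of `H_{d_K}` and `H_{f²d_K}`), an embedding `ψ : K̄ → ℂ` over
`ι`, `R' = ψ(R) ⊇ H_K(j(τ_Q))`; a prime of `𝓞_{R'}` above a prime `𝔓 ∌ f` of `𝓞_{H_K}` lies above a
prime `v ∤ f` of `K`, hence is unramified over `𝓞_K`, hence over `𝓞_{H_K}`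
(`Algebra.IsUnramifiedAt.of_restrictScalars`), and unramifiedness descends to the primes of the
subextension `H_K(j(τ_Q))` (`IsUnramifiedAt.of_liesOver_of_ne_bot`).
[cite: Cox2013, §9.A (p. 181) and §11.A Thm. 11.1] [cite: NeukirchANT1999, Ch. VI (6.2)–(6.3), (7.3)] -/
theorem isUnramifiedIn_adjoin_formJ_conductor (hK : IsImaginaryQuadratic K) (ι : K →+* ℂ)
    {f : ℕ} (hf : f ≠ 0) {Q : ℤ × ℤ × ℤ} (hQ1 : 0 < Q.1) (hprim : IsPrimitive Q)
    (hdisc : discr Q = (f : ℤ) ^ 2 * NumberField.discr K)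
    (P : Ideal (𝓞 (singularModuliField K ι))) [P.IsMaximal]
    (hP : ((f : ℕ) : 𝓞 (singularModuliField K ι)) ∉ P) :
    Algebra.IsUnramifiedIn
      (𝓞 (IntermediateField.adjoin (singularModuliField K ι) ({formJ Q} : Set ℂ))) P := by
  classical
  set Ω := AlgebraicClosure K
  set D : ℤ := NumberField.discr K with hDdef
  set D' : ℤ := (f : ℤ) ^ 2 * NumberField.discr K with hD'def
  have h2 : Module.finrank ℚ K = 2 := hK.1
  have hD : D < 0 := hK.discr_neg
  have h4 : D % 4 = 0 ∨ D % 4 = 1 := discr_emod_four h2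
  have hD' : D' < 0 := mul_neg_of_pos_of_neg (by positivity) hD
  have h4' : D' % 4 = 0 ∨ D' % 4 = 1 := sq_mul_emod_four h4 f
  have hPD : principalForm D ∈ reducedForms D := principalForm_mem_reducedForms hD h4
  have hPD' : principalForm D' ∈ reducedForms D' := principalForm_mem_reducedForms hD' h4'
  haveI : NumberField (singularModuliField K ι) :=
    numberField_singularModuliField irreducible_classPolynomial_holds hK ι
  -- `ℂ` as a `K`-algebra through `ι`
  letI : Algebra K ℂ := ι.toAlgebra
  have hιK : ∀ x : K, algebraMap K ℂ x = ι x := fun _ => rfl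
  haveI : IsScalarTower K (singularModuliField K ι) ℂ := IsScalarTower.of_algebraMap_eq fun x => rfl
  haveI : IsScalarTower ℚ K ℂ := IsScalarTower.of_algebraMap_eq fun q => by
    rw [hιK, eq_ratCast, eq_ratCast, map_ratCast]
  -- the ray class field `mod f`, and an embedding `K̄ → ℂ` over `ι`
  obtain ⟨R, hfd, hgal, hunr, hsubD, hsubD'⟩ := exists_unramified_rootSet_subset_conductor K hK hf
  haveI := hfd
  haveI := hgal
  haveI : NumberField R := NumberField.of_module_finite K R
  set ψ : Ω →ₐ[K] ℂ := IsAlgClosed.lift with hψdef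
  set φ : R →ₐ[K] ℂ := ψ.comp R.val with hφdef
  -- the complex roots of `H_E`, `E ∈ {D, D'}`, lie in `φ(R)`
  have hrange : ∀ {E : ℤ}, E < 0 → (E % 4 = 0 ∨ E % 4 = 1) →
      ((minpoly ℚ (formJ (principalForm E))).map (algebraMap ℚ K)).rootSet Ω ⊆ R →
      ∀ Q₀ ∈ reducedForms E, formJ Q₀ ∈ Set.range φ := by
    intro E hE hE4 hsub Q₀ hQ₀
    have hPE : principalForm E ∈ reducedForms E := principalForm_mem_reducedForms hE hE4
    set g : ℚ[X] := minpoly ℚ (formJ (principalForm E)) with hgdef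
    set gK : K[X] := g.map (algebraMap ℚ K) with hgKdef
    have hint : IsIntegral ℤ (formJ (principalForm E)) :=
      isIntegral_int_formJ (by rw [principalForm_fst]; exact one_pos) (isPrimitive_principalForm _)
        (by rw [discr_principalForm hE4]; exact hE)
    have hg0 : g ≠ 0 := minpoly.ne_zero hint.tower_top
    have hgK0 : gK ≠ 0 := (Polynomial.map_ne_zero_iff (algebraMap ℚ K).injective).mpr hg0
    have hgC : g.map (algebraMap ℚ ℂ) = classPolynomial E := minpoly_formJ_map_eq_classPolynomial hE hPE
    -- `formJ Q₀` is a complex root of `gK`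
    have hroot : formJ Q₀ ∈ gK.rootSet ℂ := by
      rw [mem_rootSet]
      refine ⟨hgK0, ?_⟩
      rw [hgKdef, aeval_map_algebraMap, aeval_def, eval₂_eq_eval_map, hgC, classPolynomial, eval_prod]
      exact Finset.prod_eq_zero hQ₀ (by simp)
    -- `ψ` maps the roots in `K̄` onto the complex roots
    have himage : ψ '' gK.rootSet Ω = gK.rootSet ℂ :=
      (IsAlgClosed.splits (gK.map (algebraMap K Ω))).image_rootSet ψ
    rw [← himage] at hroot
    obtain ⟨t, ht, hψt⟩ := hroot
    exact ⟨⟨t, hsub ht⟩, hψt⟩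
  -- `H_K ⊆ φ(R)` and `j(τ_Q) ∈ φ(R)`
  have hι : φ.toRingHom.comp (algebraMap K R) = ι := by
    ext x
    show ψ (algebraMap K Ω x) = ι x
    rw [ψ.commutes]
    rfl
  have hle : singularModuliField K ι ≤ φ.toRingHom.fieldRange := by
    have h := singularModuliField_le_fieldRange (K := K) φ.toRingHom (hrange hD h4 hsubD)
    rwa [hι] at h
  have hxmem : formJ Q ∈ φ.toRingHom.fieldRange := by
    have hroot := isRoot_classPolynomial_holds Q hQ1 hprim (hdisc ▸ hD')
    rw [hdisc, classPolynomial, Polynomial.isRoot_prod] at hroot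
    obtain ⟨Q', hQ', hQQ'⟩ := hroot
    have hj : formJ Q = formJ Q' := by simpa [sub_eq_zero] using hQQ'
    obtain ⟨r, hr⟩ := hrange hD' h4' hsubD' Q' hQ'
    exact ⟨r, hr.trans hj.symm⟩
  -- `R' = φ(R)` as an intermediate field of `ℂ/H_K`, `K`-isomorphic to `R`
  set R' : IntermediateField (singularModuliField K ι) ℂ :=
    (φ.toRingHom.fieldRange).toIntermediateField fun x => hle x.2 with hR'def
  have hmemR' : ∀ {z : ℂ}, z ∈ R' ↔ z ∈ φ.toRingHom.fieldRange := fun {z} => Iff.rfl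
  set e₀ : R →ₐ[K] R' :=
    { toFun := fun r => ⟨φ r, hmemR'.mpr ⟨r, rfl⟩⟩
      map_one' := Subtype.ext (map_one φ)
      map_mul' := fun a b => Subtype.ext (map_mul φ a b)
      map_zero' := Subtype.ext (map_zero φ)
      map_add' := fun a b => Subtype.ext (map_add φ a b)
      commutes' := fun k => Subtype.ext (by
        show φ (algebraMap K R k) = ((algebraMap K R' k : R') : ℂ)
        rw [φ.commutes]
        rfl) } with he₀def
  have he₀bij : Function.Bijective e₀ := by
    refine ⟨fun a b h => φ.injective (congrArg Subtype.val h), fun y => ?_⟩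
    obtain ⟨r, hr⟩ := hmemR'.mp y.2
    exact ⟨r, Subtype.ext hr⟩
  set e : R ≃ₐ[K] R' := AlgEquiv.ofBijective e₀ he₀bij with hedef
  haveI : FiniteDimensional K R' := LinearEquiv.finiteDimensional e.toLinearEquiv
  haveI : NumberField R' := NumberField.of_module_finite K R'
  haveI : FiniteDimensional (singularModuliField K ι) R' :=
    Module.Finite.of_restrictScalars_finite K (singularModuliField K ι) R'
  -- `R'/K` is unramified off `f`
  have hunrR' : ∀ v : HeightOneSpectrum (𝓞 K), ¬ Ideal.span {((f : ℕ) : 𝓞 K)} ≤ v.asIdeal →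
      Algebra.IsUnramifiedIn (𝓞 R') v.asIdeal := fun v hv =>
    isUnramifiedIn_of_algEquiv (RingOfIntegers.mapAlgEquiv e.symm) v.ne_bot (hunr v hv)
  -- the field `F = H_K(j(τ_Q)) ≤ R'`
  set F : IntermediateField (singularModuliField K ι) ℂ :=
    IntermediateField.adjoin (singularModuliField K ι) ({formJ Q} : Set ℂ) with hFdef
  have hFle : F ≤ R' := by
    rw [hFdef, IntermediateField.adjoin_le_iff, Set.singleton_subset_iff]
    exact hmemR'.mpr hxmem
  have hxint : IsIntegral ℤ (formJ Q) := isIntegral_int_formJ hQ1 hprim (by rw [hdisc]; exact hD')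
  haveI : FiniteDimensional (singularModuliField K ι) F := by
    rw [hFdef]
    exact IntermediateField.adjoin.finiteDimensional (hxint.tower_top)
  haveI : NumberField F := NumberField.of_module_finite (singularModuliField K ι) F
  set Fr : IntermediateField (singularModuliField K ι) R' := IntermediateField.restrict hFle with hFrdef
  set eF : F ≃ₐ[singularModuliField K ι] Fr := IntermediateField.restrict_algEquiv hFle with heFdef
  haveI : FiniteDimensional (singularModuliField K ι) Fr := LinearEquiv.finiteDimensional eF.toLinearEquiv
  haveI : NumberField Fr := NumberField.of_module_finite (singularModuliField K ι) Fr
  -- unramifiedness of `Fr/H_K` at `P`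
  have hPbot : P ≠ ⊥ :=
    Ring.ne_bot_of_isMaximal_of_not_isField ‹P.IsMaximal› (RingOfIntegers.not_isField _)
  have hFr : Algebra.IsUnramifiedIn (𝓞 Fr) P := by
    intro QF hQF hQFover
    have hQFbot : QF ≠ ⊥ := Ideal.ne_bot_of_liesOver_of_ne_bot hPbot QF
    haveI : QF.IsMaximal := hQF.isMaximal hQFbot
    -- a prime of `𝓞 R'` above `QF`
    obtain ⟨Q', hQ'max, hQ'over⟩ :=
      Ideal.exists_maximal_ideal_liesOver_of_isIntegral (S := 𝓞 R') QF
    haveI := hQ'max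
    haveI := hQ'over
    haveI : Q'.LiesOver P := Ideal.LiesOver.trans Q' QF P
    -- the prime of `K` below `Q'` does not contain `f`
    have hQ'bot : Q' ≠ ⊥ := Ideal.ne_bot_of_liesOver_of_ne_bot hQFbot Q'
    set v : HeightOneSpectrum (𝓞 K) :=
      ⟨Q'.under (𝓞 K), Ideal.IsPrime.under (𝓞 K) Q', mt Ideal.eq_bot_of_comap_eq_bot hQ'bot⟩ with hvdef
    haveI : Q'.LiesOver v.asIdeal := ⟨rfl⟩
    have hv : ¬ Ideal.span {((f : ℕ) : 𝓞 K)} ≤ v.asIdeal := by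
      intro hle'
      have h1 : ((f : ℕ) : 𝓞 K) ∈ Q'.under (𝓞 K) := hle' (Ideal.mem_span_singleton_self _)
      have h2 : algebraMap (𝓞 K) (𝓞 R') ((f : ℕ) : 𝓞 K) ∈ Q' := Ideal.mem_comap.mp h1
      rw [map_natCast] at h2
      apply hP
      have h3 : algebraMap (𝓞 (singularModuliField K ι)) (𝓞 R')
          ((f : ℕ) : 𝓞 (singularModuliField K ι)) ∈ Q' := by rwa [map_natCast]
      have h4 : ((f : ℕ) : 𝓞 (singularModuliField K ι)) ∈
          Q'.under (𝓞 (singularModuliField K ι)) := Ideal.mem_comap.mpr h3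
      rwa [← Ideal.LiesOver.over (P := Q') (p := P)] at h4
    -- `Q'` is unramified over `𝓞 K`, hence over `𝓞 H_K`; descend to `QF`
    haveI : Algebra.IsUnramifiedAt (𝓞 K) Q' := hunrR' v hv Q' hQ'max.isPrime inferInstance
    haveI : Algebra.IsUnramifiedAt (𝓞 (singularModuliField K ι)) Q' :=
      Algebra.IsUnramifiedAt.of_restrictScalars (𝓞 K) Q'
    exact Algebra.IsUnramifiedAt.of_liesOver (𝓞 (singularModuliField K ι)) QF Q'
  -- transport to `F`
  exact isUnramifiedIn_of_algEquiv (RingOfIntegers.mapAlgEquiv eF) hPbot hFr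

end Unramified


end Literature.NumberTheory.EllipticCurves

end
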